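import Mathlib
import Summits.Schanuel.Schanuel.Theses.RigidCore
import Summits.Schanuel.Schanuel.Theorems.AclSubsetLogFreeCore.Negative.ExpAclField
import Summits.Schanuel.Schanuel.Theorems.RoyCriterionRankOne
import Literature.NumberTheory.Transcendental.LindemannWeierstrassProofs
import Literature.NumberTheory.Transcendental.RankOneGridTrdeg

/-!
# Crux `MinimalCounterexampleInAcl` (stmt-Schanuel-0969), line `kernel-arithmetic-selection` —
# exp-image finiteness fails at DEFECT ZERO: `stub_expImageFinite_offLog` with `trdeg ≤ n` is false

The defect-zero pair `x = (πi, π)` (`n = 2`): it is ℚ-linearly independent, `trdeg ℚ(x, eˣ) =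
trdeg ℚ(π, e^π) = 2 = n` (Nesterenko, tree `algebraicIndependent_pi_exp_pi`), `SchanuelRank 0, 1`
hold (Hermite–Lindemann), `e^π` is transcendental (off-log hypothesis), and every odd multiple
`xₖ = ((2k+1)πi, (2k+1)π)` is a ℚ-linearly independent MATE of `x` — every ℚ-polynomial relation of
`(x, eˣ) = (πi, π, −1, e^π)` holds at `(xₖ, e^{xₖ}) = ((2k+1)πi, (2k+1)π, −1, e^{(2k+1)π})`, because
`π, e^π` stay algebraically independent over `ℚ(i)` (Mathlib `AlgebraicIndependent.extendScalars`),
so `π ↦ (2k+1)π, e^π ↦ e^{(2k+1)π}` extends to a `ℚ(i)`-embedding — with pairwise distinct images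
`e^{xₖ} = (−1, e^{(2k+1)π})`.  Hence `expImageFiniteOffLog_false_withLe`: the registered signature of
`stub_expImageFinite_offLog` with `<` weakened to `≤` in `Algebra.trdeg ℚ ℚ(x,eˣ) < n` is FALSE.
Finiteness of the exponential images of the mates genuinely needs `dim W = trdeg < n` (isolation of
the graph points on `W`), not merely defect `≤ 0`; compare `expImageFiniteOffLog_false_without_trdeg`
(`x = (π)`, `trdeg = n + 1`) in `TrdegLoadBearing.lean`.
-/

noncomputable section

set_option linter.dupNamespace false

open Complex Set IntermediateField
open Literature.NumberTheory.Transcendental (SchanuelRank schanuelRank_zero transcendental_exp_holds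
  trdeg_adjoin_le_mk trdeg_adjoin_union_le)
open Literature.Barriers.Schanuel (trdeg_mono)
open Summit.Schanuel.Schanuel.Theorems.AclSubsetLogFreeCore.Negative (algebraicIndependent_pi_exp_pi)

namespace Summit.Schanuel.Schanuel.Theorems.MinimalCounterexampleInAcl.Negative

/-! ## The pairs `(a·i, a)`, `a` real -/

/-- `(a i, a)` is ℚ-linearly independent for real `a ≠ 0`. -/
theorem linearIndependent_realPair {a : ℝ} (ha : a ≠ 0) :
    LinearIndependent ℚ ![(a : ℂ) * I, (a : ℂ)] := by
  refine LinearIndependent.pair_iff.2 fun s t hst => ?_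
  rw [Rat.smul_def, Rat.smul_def] at hst
  have h1 : (a : ℂ) * ((t : ℂ) + (s : ℂ) * I) = 0 := by rw [← hst]; ring
  rcases mul_eq_zero.1 h1 with h | h
  · exact absurd (Complex.ofReal_eq_zero.1 h) ha
  · have hre := congrArg Complex.re h
    have him := congrArg Complex.im h
    simp only [add_re, ratCast_re, mul_re, I_re, mul_zero, ratCast_im, I_im, mul_one, sub_self,
      add_zero, zero_re, add_im, mul_im, zero_add, zero_im] at hre him
    exact ⟨by exact_mod_cast him, by exact_mod_cast hre⟩

/-- `e^{(2k+1)πi} = −1`. -/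
theorem cexp_odd_mul_pi_mul_I (k : ℕ) :
    Complex.exp ((((2 * k + 1 : ℕ) : ℝ) * Real.pi : ℝ) * I) = -1 := by
  have h : ((((2 * k + 1 : ℕ) : ℝ) * Real.pi : ℝ) : ℂ) * I = (k : ℂ) * (2 * Real.pi * I) + Real.pi * I := by
    push_cast
    ring
  rw [h, Complex.exp_add, Complex.exp_nat_mul_two_pi_mul_I, Complex.exp_pi_mul_I]
  ring

/-- The exponential tuple of `(a i, a)` when `e^{a i} = −1`. -/
theorem cexp_comp_realPair {a : ℝ} (ha : Complex.exp ((a : ℂ) * I) = -1) :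
    (Complex.exp ∘ ![(a : ℂ) * I, (a : ℂ)]) = ![(-1 : ℂ), Complex.exp (a : ℂ)] := by
  funext i
  fin_cases i
  · simpa using ha
  · simp

/-! ## Transfer of relations along `π ↦ (2k+1)π` (Nesterenko over `ℚ(i)`) -/

/-- `i` is integral over `ℚ`. -/
theorem isIntegral_I : IsIntegral ℚ Complex.I := by
  refine ⟨Polynomial.X ^ 2 + 1, by monicity!, ?_⟩
  simp

/-- The substitution `X₁ ↦ i·T, X₂ ↦ T, Y₁ ↦ −1, Y₂ ↦ U` into `ℚ(i)[T, U]`, evaluated at `(T, U) = (a, b)`,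
computes the value of a ℚ-polynomial at `(a i, a, −1, b)`. -/
theorem aeval_subst_realPair (a b : ℂ) (p : MvPolynomial (Fin 2 ⊕ Fin 2) ℚ) :
    MvPolynomial.aeval (Sum.elim ![a * I, a] ![(-1 : ℂ), b]) p =
      (MvPolynomial.aeval ![a, b] : MvPolynomial (Fin 2) ℚ⟮Complex.I⟯ →ₐ[ℚ⟮Complex.I⟯] ℂ)
        (MvPolynomial.aeval (R := ℚ)
          (Sum.elim
            ![MvPolynomial.C (⟨Complex.I, mem_adjoin_simple_self ℚ Complex.I⟩ : ℚ⟮Complex.I⟯) *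
                MvPolynomial.X 0, MvPolynomial.X 0]
            ![MvPolynomial.C (-1 : ℚ⟮Complex.I⟯), MvPolynomial.X 1]) p) := by
  set Φ : MvPolynomial (Fin 2 ⊕ Fin 2) ℚ →ₐ[ℚ] MvPolynomial (Fin 2) ℚ⟮Complex.I⟯ :=
    MvPolynomial.aeval (R := ℚ)
      (Sum.elim
        ![MvPolynomial.C (⟨Complex.I, mem_adjoin_simple_self ℚ Complex.I⟩ : ℚ⟮Complex.I⟯) *
            MvPolynomial.X 0, MvPolynomial.X 0]
        ![MvPolynomial.C (-1 : ℚ⟮Complex.I⟯), MvPolynomial.X 1]) with hΦ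
  have key : (MvPolynomial.aeval (Sum.elim ![a * I, a] ![(-1 : ℂ), b]) :
      MvPolynomial (Fin 2 ⊕ Fin 2) ℚ →ₐ[ℚ] ℂ) =
      ((MvPolynomial.aeval ![a, b] : MvPolynomial (Fin 2) ℚ⟮Complex.I⟯ →ₐ[ℚ⟮Complex.I⟯] ℂ).restrictScalars ℚ).comp
        Φ := by
    refine MvPolynomial.algHom_ext fun i => ?_
    rcases i with i | i <;> fin_cases i
    · simp [hΦ, mul_comm]
    · simp [hΦ]
    · simp [hΦ]
    · simp [hΦ]
  exact congrArg (fun f : MvPolynomial (Fin 2 ⊕ Fin 2) ℚ →ₐ[ℚ] ℂ => f p) key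

/-- **Relations of `(πi, π, −1, e^π)` over ℚ persist at `(a i, a, −1, e^{a})` for `a = (2k+1)π`** —
indeed at ANY `(a, b)` in place of `(π, e^π)`: a ℚ-polynomial vanishing at `(πi, π, −1, e^π)` becomes,
under `X₁ ↦ iT, X₂ ↦ T, Y₁ ↦ −1, Y₂ ↦ U`, a `ℚ(i)`-polynomial vanishing at the `ℚ(i)`-algebraically
independent point `(π, e^π)` (Nesterenko + `AlgebraicIndependent.extendScalars`), hence is zero. -/
theorem aeval_realPair_eq_zero_of_aeval_piPair_eq_zero {p : MvPolynomial (Fin 2 ⊕ Fin 2) ℚ}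
    (hp : MvPolynomial.aeval (Sum.elim ![(Real.pi : ℂ) * I, (Real.pi : ℂ)]
      ![(-1 : ℂ), Complex.exp (Real.pi : ℂ)]) p = 0) (a b : ℂ) :
    MvPolynomial.aeval (Sum.elim ![a * I, a] ![(-1 : ℂ), b]) p = 0 := by
  haveI : Algebra.IsAlgebraic ℚ ℚ⟮Complex.I⟯ := isAlgebraic_adjoin_simple isIntegral_I
  have hS : AlgebraicIndependent ℚ⟮Complex.I⟯ ![(Real.pi : ℂ), Complex.exp Real.pi] :=
    algebraicIndependent_pi_exp_pi.extendScalars _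
  rw [aeval_subst_realPair] at hp ⊢
  rw [hS (hp.trans (map_zero _).symm), map_zero]

/-! ## The defect-zero witness `(πi, π)` -/

/-- `trdeg ℚ(πi, π, −1, e^π) ≤ 2` (the field lies in `ℚ(i, π, e^π)`, and `ℚ(i)` is algebraic). -/
theorem trdeg_piPair_le_two :
    Algebra.trdeg ℚ ↥(IntermediateField.adjoin ℚ (Set.range ![(Real.pi : ℂ) * I, (Real.pi : ℂ)] ∪
      Set.range (Complex.exp ∘ ![(Real.pi : ℂ) * I, (Real.pi : ℂ)]))) ≤ (2 : Cardinal) := by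
  set L : IntermediateField ℚ ℂ :=
    IntermediateField.adjoin ℚ (({Complex.I} : Set ℂ) ∪ {(Real.pi : ℂ), Complex.exp Real.pi}) with hL
  have hI : Complex.I ∈ L := subset_adjoin ℚ _ (Or.inl rfl)
  have hpi : (Real.pi : ℂ) ∈ L := subset_adjoin ℚ _ (Or.inr (Or.inl rfl))
  have hexp : Complex.exp Real.pi ∈ L := subset_adjoin ℚ _ (Or.inr (Or.inr rfl))
  have hle : IntermediateField.adjoin ℚ (Set.range ![(Real.pi : ℂ) * I, (Real.pi : ℂ)] ∪
      Set.range (Complex.exp ∘ ![(Real.pi : ℂ) * I, (Real.pi : ℂ)])) ≤ L := by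
    rw [IntermediateField.adjoin_le_iff]
    rintro z (⟨i, rfl⟩ | ⟨i, rfl⟩) <;> fin_cases i
    · exact mul_mem hpi hI
    · exact hpi
    · change Complex.exp ((Real.pi : ℂ) * I) ∈ (L : Set ℂ)
      rw [Complex.exp_pi_mul_I]
      exact L.neg_mem L.one_mem
    · exact hexp
  refine (trdeg_mono hle).trans ?_
  refine (trdeg_adjoin_union_le _ _).trans ?_
  haveI : Algebra.IsAlgebraic ℚ ℚ⟮Complex.I⟯ := isAlgebraic_adjoin_simple isIntegral_I
  have h0 : Algebra.trdeg ℚ ↥(IntermediateField.adjoin ℚ ({Complex.I} : Set ℂ)) = 0 := trdeg_eq_zero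
  have h2 : Algebra.trdeg ℚ ↥(IntermediateField.adjoin ℚ ({(Real.pi : ℂ), Complex.exp Real.pi} : Set ℂ)) ≤ 2 := by
    refine (trdeg_adjoin_le_mk _).trans ?_
    refine (Cardinal.mk_insert_le).trans ?_
    rw [Cardinal.mk_singleton]
    norm_num
  have h := add_le_add h0.le h2
  rwa [zero_add] at h

/-- `SchanuelRank r` for `r < 2` (ranks 0 and 1 are theorems: Hermite–Lindemann). -/
theorem schanuelRank_of_lt_two : ∀ r < 2, SchanuelRank r := by
  intro r hr
  interval_cases r
  · exact schanuelRank_zero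
  · exact Literature.Transcend.schanuelRank_one_of_transcendental_exp transcendental_exp_holds

/-- **`stub_expImageFinite_offLog` is false at defect zero (`≤` for `<`).**  The registered signature
with `Algebra.trdeg ℚ ℚ(x, eˣ) < n` weakened to `≤ n` is refuted by `x = (πi, π)`: LI, `trdeg ≤ 2`,
`SchanuelRank 0, 1`, `e^π` transcendental, and the mates `((2k+1)πi, (2k+1)π)`, `k ∈ ℕ`, have the
pairwise distinct exponential images `(−1, e^{(2k+1)π})`. -/
theorem expImageFiniteOffLog_false_withLe :
    ¬ ∀ (n : ℕ) (x : Fin n → ℂ), (LinearIndependent ℚ x ∧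
        Algebra.trdeg ℚ ↥(IntermediateField.adjoin ℚ (Set.range x ∪ Set.range (Complex.exp ∘ x))) ≤
          (n : Cardinal) ∧
        ∀ r < n, Literature.NumberTheory.Transcendental.SchanuelRank r) →
      (∃ i, Transcendental ℚ (Complex.exp (x i))) →
        ((fun x' : Fin n → ℂ => Complex.exp ∘ x') '' {x' : Fin n → ℂ | LinearIndependent ℚ x' ∧
          ∀ p : MvPolynomial (Fin n ⊕ Fin n) ℚ,
            MvPolynomial.aeval (Sum.elim x (Complex.exp ∘ x)) p = 0 →
            MvPolynomial.aeval (Sum.elim x' (Complex.exp ∘ x')) p = 0}).Finite := by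
  intro h
  have htr : Transcendental ℚ (Complex.exp (Real.pi : ℂ)) := by
    have := algebraicIndependent_pi_exp_pi.transcendental 1
    simpa using this
  have hfin := h 2 ![(Real.pi : ℂ) * I, (Real.pi : ℂ)]
    ⟨linearIndependent_realPair Real.pi_ne_zero, by exact_mod_cast trdeg_piPair_le_two,
      schanuelRank_of_lt_two⟩ ⟨1, by simpa using htr⟩
  have hx : (Complex.exp ∘ ![(Real.pi : ℂ) * I, (Real.pi : ℂ)]) = ![(-1 : ℂ), Complex.exp (Real.pi : ℂ)] :=
    cexp_comp_realPair (by simp)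
  -- the mates `x_k = ((2k+1)πi, (2k+1)π)` and their images
  let a : ℕ → ℝ := fun k => ((2 * k + 1 : ℕ) : ℝ) * Real.pi
  have ha0 : ∀ k, a k ≠ 0 := fun k => mul_ne_zero (by positivity) Real.pi_ne_zero
  have haI : ∀ k, Complex.exp ((a k : ℂ) * I) = -1 := fun k => cexp_odd_mul_pi_mul_I k
  let f : ℕ → (Fin 2 → ℂ) := fun k => ![(-1 : ℂ), Complex.exp (a k : ℂ)]
  have hf : Function.Injective f := by
    intro k l hkl
    have h1 : Complex.exp (a k : ℂ) = Complex.exp (a l : ℂ) := by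
      have := congr_fun hkl 1
      simpa [f] using this
    have h2 : Real.exp (a k) = Real.exp (a l) := by
      apply Complex.ofReal_injective
      simpa [Complex.ofReal_exp] using h1
    have h3 : a k = a l := Real.exp_injective h2
    have h4 : ((2 * k + 1 : ℕ) : ℝ) = ((2 * l + 1 : ℕ) : ℝ) :=
      mul_right_cancel₀ Real.pi_ne_zero h3
    have h5 : 2 * k + 1 = 2 * l + 1 := by exact_mod_cast h4
    omega
  refine ((Set.infinite_range_of_injective hf).mono ?_).not_finite hfin
  rintro _ ⟨k, rfl⟩
  refine ⟨![(a k : ℂ) * I, (a k : ℂ)], ⟨linearIndependent_realPair (ha0 k), fun p hp => ?_⟩, ?_⟩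
  · rw [cexp_comp_realPair (haI k)]
    rw [hx] at hp
    exact aeval_realPair_eq_zero_of_aeval_piPair_eq_zero hp _ _
  · simp only [f]
    exact cexp_comp_realPair (haI k)

end Summit.Schanuel.Schanuel.Theorems.MinimalCounterexampleInAcl.Negative

end
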